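import Literature.Geometry.Lorentzian.BogovskiiVectorRegularity
import Literature.Geometry.Lorentzian.BogovskiiClassicalForm
import HarnessLib

/-!
# The classical factor `Q_y(z) = ∫_1^∞ η(sz + y) s² ds` of the Bogovskiĭ kernel: size and `z`-derivative

(trunk G08 = T-LORENTZ; family `gr`; namespace `Literature.Geometry.Lorentzian.MaoOhTao`.)

Mao–Oh–Tao (arXiv:2308.13031), Lemma 2.3: in classical form the kernel of `S_η` is `Ψ^{ij}_η(z + y, y) = zᵢzⱼ Q_y(z)`
(`BogovskiiClassicalForm.lean`).  Towards the mapping property (S3) beyond order `0` one needs the derivative of the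
kernel in `x` at FIXED base point `y`, i.e. the `z`-derivative of `Q_y`:

* `abs_Q_le` — `|Q_y(z)| ≤ 2 sup|η| · T³`, `T = (R + |y|)₊/|z|` (so `|Q| ≲ |z|⁻³`);
* `hasFDerivAt_Q` — for `η ∈ C¹_c` and `z ≠ 0`, `D_zQ_y(z) = ∫_1^∞ s³ Dη(sz + y) ds` (differentiation under the
  integral sign, locally uniformly in `z ≠ 0`);
* `norm_fderivQ_le` — `‖D_zQ_y(z)‖ ≤ 2 sup‖Dη‖ · T⁴` (so `‖D_zQ‖ ≲ |z|⁻⁴`);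
* `Q_eq_zero_of_lt`, `fderivQ_eq_zero_of_lt` — both vanish for `|z| > (R + |y|)₊`;
* `hasFDerivAt_classicalKernel`, `norm_fderiv_classicalKernel_le` — the kernel `zᵢzⱼQ_y(z)` is differentiable off
  `z = 0` with `‖D_z(zᵢzⱼQ_y)(z)‖ ≤ C(η, R, ρ)/|z|²` for `|y| ≤ ρ` — an integrable singularity in `ℝ³`.

Everything is proved; no definitions, no named facts.

## References

* Y. Mao, S.-J. Oh, T. Tao, arXiv:2308.13031 (2023), Lemma 2.3, pp. 8–9 (key `MaoOhTao2023`).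
-/

noncomputable section

open scoped RealInnerProductSpace Topology
open Filter MeasureTheory Set Metric Function

namespace Literature.Geometry.Lorentzian

namespace MaoOhTao

variable {η : E3 → ℝ} {R : ℝ}

/-- **Tail-integral bound**: if `g` is continuous, `‖g‖ ≤ C`, and `g = 0` off `[−T, T]`, then `‖∫_{(a,∞)} g‖ ≤ 2TC`.
[folklore] -/
theorem norm_setIntegral_Ioi_le_of_bound {F : Type*} [NormedAddCommGroup F] [NormedSpace ℝ F] {g : ℝ → F}
    (hg : Continuous g) {T C : ℝ} (hT : 0 ≤ T) (h0 : ∀ r, T < |r| → g r = 0) (hb : ∀ r, ‖g r‖ ≤ C)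
    (a : ℝ) : ‖∫ r in Ioi a, g r‖ ≤ 2 * T * C := by
  have hout : ∀ r, r ∉ Icc (-T) T → g r = 0 := fun r hr ↦ h0 r (by
    by_contra hle
    exact hr (abs_le.1 (not_lt.1 hle)))
  have hgc : HasCompactSupport g := HasCompactSupport.intro isCompact_Icc hout
  have hgi : Integrable g := hg.integrable_of_hasCompactSupport hgc
  have hbound : ∀ r, ‖g r‖ ≤ (Icc (-T) T).indicator (fun _ ↦ C) r := fun r ↦ by
    by_cases hr : r ∈ Icc (-T) T
    · rw [indicator_of_mem hr]; exact hb r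
    · rw [indicator_of_notMem hr, hout r hr, norm_zero]
  have hind : Integrable fun r : ℝ ↦ (Icc (-T) T).indicator (fun _ ↦ C) r :=
    (integrable_indicator_iff measurableSet_Icc).2 continuous_const.integrableOn_Icc
  calc ‖∫ r in Ioi a, g r‖ ≤ ∫ r in Ioi a, ‖g r‖ := norm_integral_le_integral_norm _
    _ ≤ ∫ r, ‖g r‖ := setIntegral_le_integral hgi.norm (Eventually.of_forall fun _ ↦ norm_nonneg _)
    _ ≤ ∫ r, (Icc (-T) T).indicator (fun _ ↦ C) r := integral_mono hgi.norm hind hbound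
    _ = 2 * T * C := by
        rw [integral_indicator measurableSet_Icc, setIntegral_const, Real.volume_real_Icc_of_le (by linarith),
          smul_eq_mul]
        ring

/-- Off the support along a ray: `η(sz + y) = 0` for `|s| |z| > R + |y|`. [folklore] -/
theorem eta_ray_eq_zero (hR : ∀ z : E3, R < ‖z‖ → η z = 0) {y z : E3} {s : ℝ} (hs : R + ‖y‖ < |s| * ‖z‖) :
    η (s • z + y) = 0 := by
  apply hR
  have h1 : ‖s • z‖ = |s| * ‖z‖ := by rw [norm_smul, Real.norm_eq_abs]
  have h2 : ‖s • z‖ ≤ ‖s • z + y‖ + ‖y‖ := by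
    calc ‖s • z‖ = ‖(s • z + y) - y‖ := by rw [add_sub_cancel_right]
      _ ≤ ‖s • z + y‖ + ‖y‖ := norm_sub_le _ _
  linarith

/-- The same for the derivative. [folklore] -/
theorem fderiv_eta_ray_eq_zero (hR : ∀ z : E3, R < ‖z‖ → η z = 0) {y z : E3} {s : ℝ}
    (hs : R + ‖y‖ < |s| * ‖z‖) : fderiv ℝ η (s • z + y) = 0 := by
  have hmem : R < ‖s • z + y‖ := by
    have h1 : ‖s • z‖ = |s| * ‖z‖ := by rw [norm_smul, Real.norm_eq_abs]
    have h2 : ‖s • z‖ ≤ ‖s • z + y‖ + ‖y‖ := by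
      calc ‖s • z‖ = ‖(s • z + y) - y‖ := by rw [add_sub_cancel_right]
        _ ≤ ‖s • z + y‖ + ‖y‖ := norm_sub_le _ _
    linarith
  have hev : η =ᶠ[𝓝 (s • z + y)] fun _ ↦ 0 := by
    filter_upwards [(isOpen_lt continuous_const continuous_norm).mem_nhds hmem] with w hw
    exact hR w hw
  rw [hev.fderiv_eq, fderiv_fun_const, Pi.zero_apply]

/-- The effective width `T = (R + |y|)₊/|z|`: for `|s| > T` the ray integrands vanish. [folklore] -/
theorem lt_abs_mul_norm_of_lt {y z : E3} (hz : z ≠ 0) {s : ℝ} (hs : max (R + ‖y‖) 0 / ‖z‖ < |s|) :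
    R + ‖y‖ < |s| * ‖z‖ := by
  have hn : 0 < ‖z‖ := norm_pos_iff.2 hz
  rw [div_lt_iff₀ hn] at hs
  exact lt_of_le_of_lt (le_max_left _ _) hs

/-- **Size of `Q`**: `|Q_y(z)| ≤ 2 sup|η| T³`, `T = (R + |y|)₊/|z|`, `z ≠ 0`. [folklore] -/
theorem abs_Q_le (hη : Continuous η) (hR : ∀ z : E3, R < ‖z‖ → η z = 0) {M : ℝ} (hM : ∀ w, |η w| ≤ M)
    (y : E3) {z : E3} (hz : z ≠ 0) :
    |∫ s in Ioi (1 : ℝ), η (s • z + y) * s ^ 2| ≤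
      2 * (max (R + ‖y‖) 0 / ‖z‖) * (M * (max (R + ‖y‖) 0 / ‖z‖) ^ 2) := by
  have hn : 0 < ‖z‖ := norm_pos_iff.2 hz
  have hM0 : 0 ≤ M := (abs_nonneg _).trans (hM 0)
  set T : ℝ := max (R + ‖y‖) 0 / ‖z‖ with hT
  have hT0 : 0 ≤ T := div_nonneg (le_max_right _ _) hn.le
  rw [← Real.norm_eq_abs]
  have hg : Continuous fun s : ℝ ↦ η (s • z + y) * s ^ 2 :=
    (hη.comp ((continuous_id.smul continuous_const).add continuous_const)).mul (continuous_pow 2)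
  refine norm_setIntegral_Ioi_le_of_bound (g := fun s : ℝ ↦ η (s • z + y) * s ^ 2) hg hT0 (fun s hs ↦ ?_)
    (fun s ↦ ?_) 1
  · show η (s • z + y) * s ^ 2 = 0
    rw [eta_ray_eq_zero hR (lt_abs_mul_norm_of_lt hz hs), zero_mul]
  · show ‖η (s • z + y) * s ^ 2‖ ≤ M * T ^ 2
    by_cases hs : |s| ≤ T
    · rw [norm_mul, Real.norm_eq_abs, Real.norm_eq_abs, abs_pow]
      exact mul_le_mul (hM _) (pow_le_pow_left₀ (abs_nonneg s) hs 2) (by positivity) hM0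
    · rw [eta_ray_eq_zero hR (lt_abs_mul_norm_of_lt hz (not_le.1 hs)), zero_mul, norm_zero]
      positivity

/-- `Q_y(z) = 0` when `|z| > (R + |y|)₊` (every `s ≥ 1` is beyond the support). [folklore] -/
theorem Q_eq_zero_of_lt (hR : ∀ z : E3, R < ‖z‖ → η z = 0) {y z : E3} (hz : max (R + ‖y‖) 0 < ‖z‖) :
    ∫ s in Ioi (1 : ℝ), η (s • z + y) * s ^ 2 = 0 := by
  refine setIntegral_eq_zero_of_forall_eq_zero fun s hs ↦ ?_
  have hs1 : 1 ≤ |s| := (le_of_lt hs).trans (le_abs_self s)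
  rw [eta_ray_eq_zero hR ?_, zero_mul]
  calc R + ‖y‖ ≤ max (R + ‖y‖) 0 := le_max_left _ _
    _ < ‖z‖ := hz
    _ ≤ |s| * ‖z‖ := le_mul_of_one_le_left (norm_nonneg _) hs1

/-- **`Q_y` is differentiable in `z ≠ 0`, with derivative under the integral sign**:
`D_zQ_y(z₀) = ∫_1^∞ s³ Dη(sz₀ + y) ds` for `η ∈ C¹` vanishing off `B̄_R`. [folklore] -/
theorem hasFDerivAt_Q (hη : ContDiff ℝ 1 η) (hR : ∀ z : E3, R < ‖z‖ → η z = 0) (y : E3) {z₀ : E3}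
    (hz₀ : z₀ ≠ 0) :
    HasFDerivAt (fun z : E3 ↦ ∫ s in Ioi (1 : ℝ), η (s • z + y) * s ^ 2)
      (∫ s in Ioi (1 : ℝ), (s ^ 3) • fderiv ℝ η (s • z₀ + y)) z₀ := by
  have hηc : Continuous η := hη.continuous
  have hdc : Continuous (fderiv ℝ η) := hη.continuous_fderiv one_ne_zero
  obtain ⟨M', hM'⟩ := hdc.bounded_above_of_compact_support ((HasCompactSupport.intro (isCompact_closedBall (0 : E3) R)
    fun z hz ↦ hR z (by rwa [mem_closedBall, dist_zero_right, not_le] at hz)).fderiv (𝕜 := ℝ))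
  have hM'0 : 0 ≤ M' := (norm_nonneg _).trans (hM' 0)
  have hn₀ : 0 < ‖z₀‖ := norm_pos_iff.2 hz₀
  -- on the ball `|z - z₀| < |z₀|/2` we have `|z| ≥ |z₀|/2`, so a uniform effective width `S₀`
  set S₀ : ℝ := max (R + ‖y‖) 0 / (‖z₀‖ / 2) with hS₀
  have hS₀0 : 0 ≤ S₀ := div_nonneg (le_max_right _ _) (by positivity)
  have hzlow : ∀ z ∈ ball z₀ (‖z₀‖ / 2), ‖z₀‖ / 2 ≤ ‖z‖ := by
    intro z hz
    rw [mem_ball, dist_eq_norm] at hz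
    have := norm_sub_norm_le z₀ z
    rw [← norm_neg, neg_sub] at hz
    linarith
  have hvan : ∀ z ∈ ball z₀ (‖z₀‖ / 2), ∀ s : ℝ, S₀ < |s| → R + ‖y‖ < |s| * ‖z‖ := by
    intro z hz s hs
    have h1 := hzlow z hz
    rw [hS₀, div_lt_iff₀ (by positivity)] at hs
    calc R + ‖y‖ ≤ max (R + ‖y‖) 0 := le_max_left _ _
      _ < |s| * (‖z₀‖ / 2) := hs
      _ ≤ |s| * ‖z‖ := mul_le_mul_of_nonneg_left h1 (abs_nonneg s)
  set F : E3 → ℝ → ℝ := fun z s ↦ η (s • z + y) * s ^ 2 with hF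
  set F' : E3 → ℝ → (E3 →L[ℝ] ℝ) := fun z s ↦ (s ^ 3) • fderiv ℝ η (s • z + y) with hF'
  have hFc : ∀ z, Continuous (F z) := fun z ↦
    (hηc.comp ((continuous_id.smul continuous_const).add continuous_const)).mul (continuous_pow 2)
  have hF'c : ∀ z, Continuous (F' z) := fun z ↦
    (continuous_pow 3).smul (hdc.comp ((continuous_id.smul continuous_const).add continuous_const))
  have hF_meas : ∀ᶠ z in 𝓝 z₀, AEStronglyMeasurable (F z) (volume.restrict (Ioi 1)) :=
    Eventually.of_forall fun z ↦ (hFc z).aestronglyMeasurable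
  have hF_int : Integrable (F z₀) (volume.restrict (Ioi 1)) := by
    refine ((hFc z₀).integrable_of_hasCompactSupport (HasCompactSupport.intro (isCompact_Icc (a := -S₀) (b := S₀))
      fun s hs ↦ ?_)).restrict
    have hs' : S₀ < |s| := by
      by_contra hle
      exact hs (abs_le.1 (not_lt.1 hle))
    show η (s • z₀ + y) * s ^ 2 = 0
    rw [eta_ray_eq_zero hR (hvan z₀ (mem_ball_self (by positivity)) s hs'), zero_mul]
  have hF'_meas : AEStronglyMeasurable (F' z₀) (volume.restrict (Ioi 1)) := (hF'c z₀).aestronglyMeasurable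
  have h_bound : ∀ᵐ s ∂(volume.restrict (Ioi 1)), ∀ z ∈ ball z₀ (‖z₀‖ / 2), ‖F' z s‖ ≤
      (Icc (-S₀) S₀).indicator (fun _ ↦ M' * S₀ ^ 3) s := by
    refine ae_of_all _ fun s z hz ↦ ?_
    by_cases hs : s ∈ Icc (-S₀) S₀
    · rw [indicator_of_mem hs, hF', norm_smul, Real.norm_eq_abs, abs_pow, mul_comm]
      exact mul_le_mul (hM' _) (pow_le_pow_left₀ (abs_nonneg s) (abs_le.2 ⟨hs.1, hs.2⟩) 3) (by positivity) hM'0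
    · rw [indicator_of_notMem hs]
      have hs' : S₀ < |s| := by
        by_contra hle
        exact hs (abs_le.1 (not_lt.1 hle))
      simp only [hF']
      rw [fderiv_eta_ray_eq_zero hR (hvan z hz s hs'), smul_zero, norm_zero]
  have hbi : Integrable (fun s : ℝ ↦ (Icc (-S₀) S₀).indicator (fun _ ↦ M' * S₀ ^ 3) s) (volume.restrict (Ioi 1)) :=
    ((integrable_indicator_iff measurableSet_Icc).2 continuous_const.integrableOn_Icc).restrict
  have h_diff : ∀ᵐ s ∂(volume.restrict (Ioi 1)), ∀ z ∈ ball z₀ (‖z₀‖ / 2), HasFDerivAt (F · s) (F' z s) z := by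
    refine ae_of_all _ fun s z _ ↦ ?_
    have h1 : HasFDerivAt (fun z : E3 ↦ s • z + y) (s • ContinuousLinearMap.id ℝ E3) z :=
      ((hasFDerivAt_id z).const_smul s).add_const y
    have h2 : HasFDerivAt η (fderiv ℝ η (s • z + y)) (s • z + y) := (hη.differentiable one_ne_zero _).hasFDerivAt
    have h3 := (h2.comp z h1).mul_const (s ^ 2)
    have heq : (s ^ 2) • (fderiv ℝ η (s • z + y)).comp (s • ContinuousLinearMap.id ℝ E3) = F' z s := by
      ext v
      simp [hF']
      ring
    rw [← heq]
    simpa only [Function.comp_def] using h3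
  exact hasFDerivAt_integral_of_dominated_of_fderiv_le (ball_mem_nhds z₀ (by positivity)) hF_meas hF_int hF'_meas
    h_bound hbi h_diff

/-- **Size of `D_zQ`**: `‖∫_1^∞ s³ Dη(sz + y) ds‖ ≤ 2 sup‖Dη‖ T⁴`, `T = (R + |y|)₊/|z|`, `z ≠ 0`. [folklore] -/
theorem norm_fderivQ_le (hη : ContDiff ℝ 1 η) (hR : ∀ z : E3, R < ‖z‖ → η z = 0) {M' : ℝ}
    (hM' : ∀ w, ‖fderiv ℝ η w‖ ≤ M') (y : E3) {z : E3} (hz : z ≠ 0) :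
    ‖∫ s in Ioi (1 : ℝ), (s ^ 3) • fderiv ℝ η (s • z + y)‖ ≤
      2 * (max (R + ‖y‖) 0 / ‖z‖) * (M' * (max (R + ‖y‖) 0 / ‖z‖) ^ 3) := by
  have hn : 0 < ‖z‖ := norm_pos_iff.2 hz
  have hM'0 : 0 ≤ M' := (norm_nonneg _).trans (hM' 0)
  have hdc : Continuous (fderiv ℝ η) := hη.continuous_fderiv one_ne_zero
  set T : ℝ := max (R + ‖y‖) 0 / ‖z‖ with hT
  have hT0 : 0 ≤ T := div_nonneg (le_max_right _ _) hn.le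
  have hg : Continuous fun s : ℝ ↦ (s ^ 3) • fderiv ℝ η (s • z + y) :=
    (continuous_pow 3).smul (hdc.comp ((continuous_id.smul continuous_const).add continuous_const))
  refine norm_setIntegral_Ioi_le_of_bound (g := fun s : ℝ ↦ (s ^ 3) • fderiv ℝ η (s • z + y)) hg hT0
    (fun s hs ↦ ?_) (fun s ↦ ?_) 1
  · show (s ^ 3) • fderiv ℝ η (s • z + y) = 0
    rw [fderiv_eta_ray_eq_zero hR (lt_abs_mul_norm_of_lt hz hs), smul_zero]
  · show ‖(s ^ 3) • fderiv ℝ η (s • z + y)‖ ≤ M' * T ^ 3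
    by_cases hs : |s| ≤ T
    · rw [norm_smul, Real.norm_eq_abs, abs_pow, mul_comm]
      exact mul_le_mul (hM' _) (pow_le_pow_left₀ (abs_nonneg s) hs 3) (by positivity) hM'0
    · rw [fderiv_eta_ray_eq_zero hR (lt_abs_mul_norm_of_lt hz (not_le.1 hs)), smul_zero, norm_zero]
      positivity

/-- `D_zQ_y(z) = 0` when `|z| > (R + |y|)₊`. [folklore] -/
theorem fderivQ_eq_zero_of_lt (hR : ∀ z : E3, R < ‖z‖ → η z = 0) {y z : E3} (hz : max (R + ‖y‖) 0 < ‖z‖) :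
    ∫ s in Ioi (1 : ℝ), (s ^ 3) • fderiv ℝ η (s • z + y) = 0 := by
  refine setIntegral_eq_zero_of_forall_eq_zero fun s hs ↦ ?_
  have hs1 : 1 ≤ |s| := (le_of_lt hs).trans (le_abs_self s)
  rw [fderiv_eta_ray_eq_zero hR ?_, smul_zero]
  calc R + ‖y‖ ≤ max (R + ‖y‖) 0 := le_max_left _ _
    _ < ‖z‖ := hz
    _ ≤ |s| * ‖z‖ := le_mul_of_one_le_left (norm_nonneg _) hs1

/-! ### The kernel `zᵢzⱼ Q_y(z)` -/

/-- **The classical kernel is differentiable off `z = 0`**, by the product rule: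
`D_z(zᵢzⱼQ_y)(z₀) = zⱼQ · projᵢ + zᵢQ · projⱼ + zᵢzⱼ · D_zQ` (in the order produced by `HasFDerivAt.mul`). [folklore] -/
theorem hasFDerivAt_classicalKernel (hη : ContDiff ℝ 1 η) (hR : ∀ z : E3, R < ‖z‖ → η z = 0) (y : E3)
    {z₀ : E3} (hz₀ : z₀ ≠ 0) (i j : Fin 3) :
    HasFDerivAt (fun z : E3 ↦ z i * z j * ∫ s in Ioi (1 : ℝ), η (s • z + y) * s ^ 2)
      ((z₀ i * z₀ j) • (∫ s in Ioi (1 : ℝ), (s ^ 3) • fderiv ℝ η (s • z₀ + y)) +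
        (∫ s in Ioi (1 : ℝ), η (s • z₀ + y) * s ^ 2) •
          (z₀ i • (EuclideanSpace.proj j : E3 →L[ℝ] ℝ) + z₀ j • (EuclideanSpace.proj i : E3 →L[ℝ] ℝ))) z₀ := by
  have hpi : HasFDerivAt (fun z : E3 ↦ z i) (EuclideanSpace.proj i : E3 →L[ℝ] ℝ) z₀ :=
    (EuclideanSpace.proj (𝕜 := ℝ) i).hasFDerivAt
  have hpj : HasFDerivAt (fun z : E3 ↦ z j) (EuclideanSpace.proj j : E3 →L[ℝ] ℝ) z₀ :=
    (EuclideanSpace.proj (𝕜 := ℝ) j).hasFDerivAt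
  have hQ := hasFDerivAt_Q hη hR y hz₀
  exact (hpi.mul hpj).mul hQ

/-- **Bound for the kernel derivative**: for `|y| ≤ ρ`, `0 ≤ R + ρ` and `z ≠ 0`,
`‖D_z(zᵢzⱼQ_y)(z)‖ ≤ (4 sup|η| (R+ρ)³ + 2 sup‖Dη‖ (R+ρ)⁴)/|z|²`, and `= 0` for `|z| > R + ρ`. [folklore] -/
theorem norm_fderiv_classicalKernel_le (hη : ContDiff ℝ 1 η) (hR : ∀ z : E3, R < ‖z‖ → η z = 0) {M M' ρ : ℝ}
    (hM : ∀ w, |η w| ≤ M) (hM' : ∀ w, ‖fderiv ℝ η w‖ ≤ M') (hRρ : 0 ≤ R + ρ) {y : E3} (hy : ‖y‖ ≤ ρ) {z : E3}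
    (hz : z ≠ 0) (i j : Fin 3) :
    ‖(z i * z j) • (∫ s in Ioi (1 : ℝ), (s ^ 3) • fderiv ℝ η (s • z + y)) +
        (∫ s in Ioi (1 : ℝ), η (s • z + y) * s ^ 2) •
          (z i • (EuclideanSpace.proj j : E3 →L[ℝ] ℝ) + z j • (EuclideanSpace.proj i : E3 →L[ℝ] ℝ))‖ ≤
      (closedBall (0 : E3) (R + ρ)).indicator (fun z ↦ (4 * M * (R + ρ) ^ 3 + 2 * M' * (R + ρ) ^ 4) * (‖z‖ ^ 2)⁻¹) z := by
  have hn : 0 < ‖z‖ := norm_pos_iff.2 hz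
  have hM0 : 0 ≤ M := (abs_nonneg _).trans (hM 0)
  have hM'0 : 0 ≤ M' := (norm_nonneg _).trans (hM' 0)
  have hmaxle : max (R + ‖y‖) 0 ≤ R + ρ := max_le (by linarith) hRρ
  by_cases hzD : z ∈ closedBall (0 : E3) (R + ρ)
  · rw [indicator_of_mem hzD]
    set T : ℝ := max (R + ‖y‖) 0 / ‖z‖ with hT
    have hT0 : 0 ≤ T := div_nonneg (le_max_right _ _) hn.le
    have hTle : T * ‖z‖ ≤ R + ρ := by rw [hT, div_mul_cancel₀ _ hn.ne']; exact hmaxle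
    have hQ : |∫ s in Ioi (1 : ℝ), η (s • z + y) * s ^ 2| ≤ 2 * T * (M * T ^ 2) := abs_Q_le hη.continuous hR hM y hz
    have hDQ : ‖∫ s in Ioi (1 : ℝ), (s ^ 3) • fderiv ℝ η (s • z + y)‖ ≤ 2 * T * (M' * T ^ 3) :=
      norm_fderivQ_le hη hR hM' y hz
    have hzi : |z i| ≤ ‖z‖ := by simpa using PiLp.norm_apply_le z i
    have hzj : |z j| ≤ ‖z‖ := by simpa using PiLp.norm_apply_le z j
    have hproj : ∀ k : Fin 3, ‖(EuclideanSpace.proj k : E3 →L[ℝ] ℝ)‖ ≤ 1 := fun k ↦ by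
      refine ContinuousLinearMap.opNorm_le_bound _ zero_le_one fun v ↦ ?_
      rw [one_mul]
      simpa using PiLp.norm_apply_le v k
    calc ‖(z i * z j) • (∫ s in Ioi (1 : ℝ), (s ^ 3) • fderiv ℝ η (s • z + y)) +
          (∫ s in Ioi (1 : ℝ), η (s • z + y) * s ^ 2) •
            (z i • (EuclideanSpace.proj j : E3 →L[ℝ] ℝ) + z j • (EuclideanSpace.proj i : E3 →L[ℝ] ℝ))‖
        ≤ |z i| * |z j| * (2 * T * (M' * T ^ 3)) + 2 * T * (M * T ^ 2) * (|z i| * 1 + |z j| * 1) := by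
          refine (norm_add_le _ _).trans (add_le_add ?_ ?_)
          · rw [norm_smul, Real.norm_eq_abs, abs_mul]
            exact mul_le_mul_of_nonneg_left hDQ (by positivity)
          · rw [norm_smul, Real.norm_eq_abs]
            refine mul_le_mul hQ ((norm_add_le _ _).trans (add_le_add ?_ ?_)) (norm_nonneg _) (by positivity)
            · rw [norm_smul, Real.norm_eq_abs]; exact mul_le_mul_of_nonneg_left (hproj j) (abs_nonneg _)
            · rw [norm_smul, Real.norm_eq_abs]; exact mul_le_mul_of_nonneg_left (hproj i) (abs_nonneg _)
      _ ≤ ‖z‖ * ‖z‖ * (2 * T * (M' * T ^ 3)) + 2 * T * (M * T ^ 2) * (‖z‖ * 1 + ‖z‖ * 1) := by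
          gcongr
      _ = (4 * M * (T * ‖z‖) ^ 3 + 2 * M' * (T * ‖z‖) ^ 4) * (‖z‖ ^ 2)⁻¹ := by
          field_simp
          ring
      _ ≤ (4 * M * (R + ρ) ^ 3 + 2 * M' * (R + ρ) ^ 4) * (‖z‖ ^ 2)⁻¹ := by
          have hTz0 : 0 ≤ T * ‖z‖ := by positivity
          gcongr
  · rw [indicator_of_notMem hzD]
    rw [mem_closedBall, dist_zero_right, not_le] at hzD
    have hzlt : max (R + ‖y‖) 0 < ‖z‖ := lt_of_le_of_lt hmaxle hzD
    rw [Q_eq_zero_of_lt hR hzlt, fderivQ_eq_zero_of_lt hR hzlt, smul_zero, zero_smul, add_zero, norm_zero]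

end MaoOhTao

end Literature.Geometry.Lorentzian

end
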